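/-
Copyright (c) 2026 the pub-hodgecm-mathlib formalisation cell (harness21).  Prover seat hodgecm-mathlib-LH4-p02 (g7) on the signature sheet of planner LH4-plan (g6)
(WORD #3∕#4 «WILD TYPE-(2) EXPONENT LAW», 2026-09-02; sheet sha16 20c368455d4bd0ab).
-/
import Literature.NumberTheory.LocalFields.WildQuadraticNormDescent   -- ★ `valued_uniformizer_zpow`; brings ★ `WildQuadraticNormsExactness` ((X3) `valued_sub_one_le_valued_mul_sq_sub_one_of_odd`, `valued_mul_self_sub_one_of_gt`)
import HarnessLib

/-!
# The order of a monic quadratic at a point of a discretely valued field — domination and cancellation rows at ANY residue characteristic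
# (the dyadic siblings of the type-(2) exponent law `n = min(2N+1, 2M)`)

Topic `NumberTheory/LocalFields`; namespace `Literature.NumberTheory.LocalFields`.  THEOREMS ONLY (no definition, no instance, no notation, no named fact, no `sorry`);
CM-free; count-neutral; kernel lane `--supports stmt-HodgeConjecture-24833`.  Cell `pub/hodgecm-mathlib` (D-0151), crux H413 = `stmt-HodgeConjecture-24833`, half A line
LH4 (closer row `stub_N6ns` CLOSED-DERIVED; live residual row #183 «LT-DYADIC» PRINT [LS₂]).  Brick «WILD TYPE-(2) EXPONENT LAW» (planner LH4-plan (g6) WORD #3): the dyadic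
siblings of ★ `Rogawski1990.FinExplicitTransferFactorInertExponent.valued_quadratic_eval_eq_exp_neg_min` (:234, which assumes `v 2 = 1`), in the define-free
`Valued K ℤᵐ⁰` currency of the ★ wild quadratic layer (★ `LocalFields/WildQuadraticNormGroupAPI` and its imports).  This file pays no organ and opens no road (desk
D74′ ∕ census OUTCOME B stand): it is base-layer valued-field algebra, the `D`-part of mechanism M3 (the `Δ‴`-exponent on wild type-(2) tori) read without `h2`.
HONEST LABEL: HC_CM is proved only modulo the 7 printed citations (2 remaining: hLiu418 = stmt-HodgeConjecture-24832, h413 = stmt-HodgeConjecture-24833) until rung 0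
closes.

THE MATHEMATICS.  For a monic quadratic `X² − tX + d` and a point `b`:  `4·(b² − t b + d) = (t − 2b)² − (t² − 4d)` (W0).  Write `v(t² − 4d) = exp(−D)`, `v(t − 2b) = exp(−M)`.
* (W1) DOMINATION ROW (any residue characteristic): `D ≠ 2M ⇒ v(4(b² − tb + d)) = exp(−min(D, 2M))`; with `v 2 = exp(−e)`: `v(b² − tb + d) = exp(2e − min(D, 2M))` (W1′).
  At `e = 0` and `D = 2N+1` this is ★ `valued_quadratic_eval_eq_exp_neg_min` (cited, not imported).
* (W2) CANCELLATION ROW (`D = 2M =: 2r`, possible only for `D` even): with a uniformiser `ϖ`, `c₀ := (t − 2b)ϖ^{−r}`, `η := (t² − 4d)ϖ^{−2r}` are units and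
  `v(4(b² − tb + d)) = exp(−2r) · v(c₀² − η)` (re-centring, W2); the content is the DEFECT BOUND (W2d): if `η = 1 + w` with `v 4 < v w` and `v w` not a square value
  (odd defect `s = ord w < 2e`), then `v w ≤ v(x·x − η)` for EVERY `x` (so `J := ord(c₀² − η) ≤ s`), with equality at `x = 1` (W2d=), and (W2v) every EVEN value `2j < s` of
  `ord(x² − η)` occurs (`x = 1 + ϖ^j`, `j < e`).  (W2d) is a corollary of ★ (X3) `valued_sub_one_le_valued_mul_sq_sub_one_of_odd` «AN ODD DEFECT IS RIGID» (the unit case,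
  at `t = x⁻¹`: `x·x − η = −x²·(η·x⁻² − 1)`); a non-unit `x` is plain domination.  No completeness, no finiteness of the residue field is used anywhere.
* Reading for M3 (words only; the Rogawski-side dictionary is not typed here): at a place `v` inert-UNRAMIFIED in `L∕L⁺`, for a regular elliptic type-(2) class
  `γ_H = (g, u)` the algebra `K₂ = L_w[g]` is Galois biquadratic over `L⁺_v`, hence `K₂∕L_w` is RAMIFIED: `d(K₂∕L_w) = 1` at odd residue characteristic,
  `d ∈ {2, 4, …, 2e} ∪ {2e+1}` at `v ∣ 2` (`e = ord_w 2`), and `ord_w(t² − 4δ) = d + 2·j(g)` (★ `RamifiedPlaceOrderDiscriminant`).  Then `n := ord_w χ_g(u) = min(D, 2M) − 2e`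
  on the domination row (for `d = 2e+1`: `n = min(2j+1, 2M′)`, `M′ = M − e` — the odd column verbatim), and `n = 2r − 2e + J`, `J ≤ s = 2e + 1 − d`, on the cancellation row;
  value set `{0, 2, …, 2j} ∪ {2j+1}` in every family.

## References
* [Omeara1963] O. T. O'Meara, *Introduction to Quadratic Forms*, Grundlehren 117 (1963), §11 (principle of domination), §63A 63:2–63:5 (the quadratic defect).
* [Serre1979] J.-P. Serre, *Local Fields*, GTM 67 (1979), Ch. XIV §4, Ch. XV §2.
* [Flicker1998UnitaryFL] Y. Z. Flicker, *Elementary proof of the fundamental lemma for a unitary group*, Canad. J. Math. 50 (1998), §6 Thm. 18 p. 97 (`n = min(1+2N, 2+2N₂)`).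
* [Rogawski1990] J. D. Rogawski, *Automorphic Representations of Unitary Groups in Three Variables*, Ann. of Math. Stud. 123 (1990), §4.9 p. 55.
-/

set_option autoImplicit false

noncomputable section

open scoped Valued WithZero
open WithZero

namespace Literature.NumberTheory.LocalFields

section EvalOrder
variable {K : Type*} [Field K] [Valued K ℤᵐ⁰]

omit [Valued K ℤᵐ⁰] in
/-- **(W0)** `4·(b² − t b + d) = (t − 2b)² − (t² − 4d)`. [cite: Omeara1963, §11] -/
theorem four_mul_quadratic_eval_eq (t d b : K) : 4 * (b ^ 2 - t * b + d) = (t - 2 * b) ^ 2 - (t ^ 2 - 4 * d) := by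
  ring

/-- **(W1) DOMINATION ROW** (any residue characteristic): `v(t² − 4d) = exp(−D)`, `v(t − 2b) = exp(−M)`, `D ≠ 2M` ⇒ `v(4(b² − tb + d)) = exp(−min(D, 2M))`.
[cite: Omeara1963, §11] [cite: Flicker1998UnitaryFL, §6 Thm. 18 p. 97] -/
theorem valued_four_mul_quadratic_eval_of_ne {t d b : K} {D M : ℕ}
    (hD : Valued.v (t ^ 2 - 4 * d) = exp (-(D : ℤ))) (hM : Valued.v (t - 2 * b) = exp (-(M : ℤ))) (hne : D ≠ 2 * M) :
    Valued.v (4 * (b ^ 2 - t * b + d)) = exp (-((min D (2 * M) : ℕ) : ℤ)) := by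
  have hx : Valued.v ((t - 2 * b) ^ 2) = exp (-((2 * M : ℕ) : ℤ)) := by
    rw [map_pow, hM, pow_two, ← WithZero.exp_add]
    congr 1; push_cast; ring
  rw [four_mul_quadratic_eval_eq]
  rcases Nat.lt_or_ge (2 * M) D with hlt | hge
  · -- `v(t² − 4d) < v((t − 2b)²)`: the square dominates, `min = 2M`
    have h : Valued.v (t ^ 2 - 4 * d) < Valued.v ((t - 2 * b) ^ 2) := by
      rw [hx, hD, WithZero.exp_lt_exp]; push_cast; omega
    rw [Valuation.map_sub_eq_of_lt_left _ h, hx, min_eq_right hlt.le]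
  · -- `D < 2M` (as `D ≠ 2M`): the discriminant dominates, `min = D`
    have hlt : D < 2 * M := lt_of_le_of_ne hge hne
    have h : Valued.v ((t - 2 * b) ^ 2) < Valued.v (t ^ 2 - 4 * d) := by
      rw [hx, hD, WithZero.exp_lt_exp]; push_cast; omega
    rw [Valuation.map_sub_eq_of_lt_right _ h, hD, min_eq_left hlt.le]

/-- **(W1′) DOMINATION ROW, `4` removed**: with `v 2 = exp(−e)`, `v(b² − tb + d) = exp(2e − min(D, 2M))`.  At `e = 0`, `D = 2N + 1` this is ★
`Rogawski1990.valued_quadratic_eval_eq_exp_neg_min`. [cite: Omeara1963, §11] [cite: Flicker1998UnitaryFL, §6 Thm. 18 p. 97] -/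
theorem valued_quadratic_eval_of_ne {t d b : K} {D M e : ℕ} (he : Valued.v (2 : K) = exp (-(e : ℤ)))
    (hD : Valued.v (t ^ 2 - 4 * d) = exp (-(D : ℤ))) (hM : Valued.v (t - 2 * b) = exp (-(M : ℤ))) (hne : D ≠ 2 * M) :
    Valued.v (b ^ 2 - t * b + d) = exp (2 * (e : ℤ) - ((min D (2 * M) : ℕ) : ℤ)) := by
  have h4 : Valued.v (4 : K) = exp (-(2 * (e : ℤ))) := by
    rw [show (4 : K) = 2 * 2 by norm_num, map_mul, he, ← WithZero.exp_add]
    congr 1; ring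
  have h := valued_four_mul_quadratic_eval_of_ne hD hM hne
  rw [map_mul, h4] at h
  calc Valued.v (b ^ 2 - t * b + d)
      = (exp (-(2 * (e : ℤ))))⁻¹ * (exp (-(2 * (e : ℤ))) * Valued.v (b ^ 2 - t * b + d)) := by
        rw [inv_mul_cancel_left₀ WithZero.exp_ne_zero]
    _ = exp (2 * (e : ℤ) - ((min D (2 * M) : ℕ) : ℤ)) := by
        rw [h, ← WithZero.exp_neg, ← WithZero.exp_add]
        congr 1; ring

/-- **(W2) CANCELLATION ROW, re-centred**: `v(t² − 4d) = exp(−2r)`, `v(t − 2b) = exp(−r)`, `ϖ` a uniformiser ⇒ `c₀ = (t − 2b)∕ϖ^r` and `η = (t² − 4d)∕ϖ^{2r}` are units and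
`v(4(b² − tb + d)) = exp(−2r) · v(c₀² − η)`. [cite: Omeara1963, §63A] -/
theorem valued_four_mul_quadratic_eval_of_eq {ϖ t d b : K} (hϖ : Valued.v ϖ = exp (-1 : ℤ)) {r : ℕ}
    (hD : Valued.v (t ^ 2 - 4 * d) = exp (-((2 * r : ℕ) : ℤ))) (hM : Valued.v (t - 2 * b) = exp (-(r : ℤ))) :
    Valued.v ((t - 2 * b) / ϖ ^ r) = 1 ∧ Valued.v ((t ^ 2 - 4 * d) / ϖ ^ (2 * r)) = 1 ∧
      Valued.v (4 * (b ^ 2 - t * b + d)) = exp (-((2 * r : ℕ) : ℤ)) * Valued.v (((t - 2 * b) / ϖ ^ r) ^ 2 - (t ^ 2 - 4 * d) / ϖ ^ (2 * r)) := by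
  have hϖ0 : ϖ ≠ 0 := by
    intro h
    rw [h, map_zero] at hϖ
    exact WithZero.exp_ne_zero hϖ.symm
  have hϖr : Valued.v (ϖ ^ r) = exp (-(r : ℤ)) := by
    rw [← zpow_natCast]
    exact valued_uniformizer_zpow hϖ _
  have hϖ2r : Valued.v (ϖ ^ (2 * r)) = exp (-((2 * r : ℕ) : ℤ)) := by
    rw [← zpow_natCast]
    exact valued_uniformizer_zpow hϖ _
  refine ⟨?_, ?_, ?_⟩
  · rw [map_div₀, hM, hϖr, div_self WithZero.exp_ne_zero]
  · rw [map_div₀, hD, hϖ2r, div_self WithZero.exp_ne_zero]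
  · have hr0 : ϖ ^ r ≠ 0 := pow_ne_zero _ hϖ0
    have h2r0 : ϖ ^ (2 * r) ≠ 0 := pow_ne_zero _ hϖ0
    have key : 4 * (b ^ 2 - t * b + d) = ϖ ^ (2 * r) * (((t - 2 * b) / ϖ ^ r) ^ 2 - (t ^ 2 - 4 * d) / ϖ ^ (2 * r)) := by
      rw [four_mul_quadratic_eval_eq, mul_sub, mul_div_cancel₀ _ h2r0, div_pow, ← pow_mul, mul_comm r 2, mul_div_cancel₀ _ h2r0]
    rw [key, map_mul, hϖ2r]

/-- **(W2d) THE DEFECT BOUND**: `η = 1 + w` with `v 4 < v w` and `v w` not a square value (odd defect `s < 2e`) ⇒ `v w ≤ v(x·x − (1 + w))` for every `x` — `ord(x² − η) ≤ s`.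
For a unit `x` this is ★ (X3) `valued_sub_one_le_valued_mul_sq_sub_one_of_odd` at `u = 1 + w`, `t = x⁻¹`; otherwise `v(x·x) ≠ v(1 + w)` and domination.
(No completeness, no residue-field hypothesis.) [cite: Omeara1963, §63A 63:2–63:5] [cite: Serre1979, Ch. XIV §4] -/
theorem valued_le_valued_mul_self_sub_one_add {w : K} (h4w : Valued.v (4 : K) < Valued.v w) (hwodd : ∀ y : K, Valued.v w ≠ Valued.v y * Valued.v y) (x : K) :
    Valued.v w ≤ Valued.v (x * x - (1 + w)) := by
  -- `v w` is not the square value `1 = v 1 · v 1`, so `v w ≤ v (1 + w)` by domination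
  have hw1 : Valued.v w ≠ 1 := by simpa using hwodd 1
  have hle : Valued.v w ≤ Valued.v (1 + w) := by
    rcases hw1.lt_or_gt with hlt | hgt
    · rw [Valuation.map_add_eq_of_lt_left _ (by rwa [Valuation.map_one]), Valuation.map_one]
      exact hlt.le
    · rw [Valuation.map_add_eq_of_lt_right _ (by rwa [Valuation.map_one])]
  by_cases hx : Valued.v (x * x) = Valued.v (1 + w)
  · -- then `v w < 1`, `x` is a unit, and ★ (X3) applies at `u = 1 + w`, `t = x⁻¹`
    have hlt : Valued.v w < 1 := by
      refine hw1.lt_or_gt.resolve_right fun hgt => hwodd x ?_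
      rw [← map_mul, hx, Valuation.map_add_eq_of_lt_right _ (by rwa [Valuation.map_one])]
    have h1w : Valued.v (1 + w) = 1 := by
      rw [Valuation.map_add_eq_of_lt_left _ (by rwa [Valuation.map_one]), Valuation.map_one]
    rw [h1w, map_mul, ← pow_two] at hx
    have hx1 : Valued.v x = 1 := (pow_eq_one_iff_of_nonneg zero_le two_ne_zero).1 hx
    have hx0 : x ≠ 0 := by
      intro h
      rw [h, map_zero] at hx1
      exact zero_ne_one hx1
    have ht : Valued.v x⁻¹ = 1 := by rw [map_inv₀, hx1, inv_one]
    have h4u : Valued.v (4 : K) < Valued.v ((1 + w) - 1) := by rwa [add_sub_cancel_left]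
    have hodd : ∀ y : K, Valued.v ((1 + w) - 1) ≠ Valued.v y * Valued.v y := by
      rw [add_sub_cancel_left]
      exact hwodd
    have h := valued_sub_one_le_valued_mul_sq_sub_one_of_odd h4u hodd ht
    rw [add_sub_cancel_left] at h
    have key : x * x - (1 + w) = -(x * x) * ((1 + w) * (x⁻¹ * x⁻¹) - 1) := by
      field_simp
      ring
    rw [key, map_mul, Valuation.map_neg, map_mul, hx1, one_mul, one_mul]
    exact h
  · -- distinct values: `v(x·x − (1 + w)) = max (v (x·x)) (v (1 + w)) ≥ v (1 + w) ≥ v w`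
    rw [sub_eq_add_neg, Valuation.map_add_of_distinct_val _ (by rwa [Valuation.map_neg]), Valuation.map_neg]
    exact hle.trans (le_max_right _ _)

/-- **(W2d=) sharpness**: equality at `x = 1`. [cite: Omeara1963, §63A 63:2] -/
theorem valued_one_mul_one_sub_one_add (w : K) : Valued.v ((1 : K) * 1 - (1 + w)) = Valued.v w := by
  rw [one_mul, sub_add_cancel_left, Valuation.map_neg]

/-- **(W2v) THE EVEN VALUES OCCUR**: with `v 2 = exp(−e)`, a uniformiser `ϖ`, `j < e` and `exp(−2j) > v w`: `v((1 + ϖ^j)(1 + ϖ^j) − (1 + w)) = exp(−2j)` — by ★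
`valued_mul_self_sub_one_of_gt` (`v 2 < v ϖ^j`, a square value `exp(−2j)`) and domination against `w`. [cite: Omeara1963, §63A 63:5] -/
theorem valued_mul_self_sub_one_add_of_lt {ϖ w : K} (hϖ : Valued.v ϖ = exp (-1 : ℤ)) {e j : ℕ} (he : Valued.v (2 : K) = exp (-(e : ℤ))) (hje : j < e)
    (hjw : Valued.v w < exp (-((2 * j : ℕ) : ℤ))) :
    Valued.v ((1 + ϖ ^ j) * (1 + ϖ ^ j) - (1 + w)) = exp (-((2 * j : ℕ) : ℤ)) := by
  have hϖj : Valued.v ((1 + ϖ ^ j) - 1) = exp (-(j : ℤ)) := by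
    rw [add_sub_cancel_left, ← zpow_natCast]
    exact valued_uniformizer_zpow hϖ _
  have hgt : Valued.v (2 : K) < Valued.v ((1 + ϖ ^ j) - 1) := by
    rw [he, hϖj, WithZero.exp_lt_exp]; omega
  have hA : Valued.v ((1 + ϖ ^ j) * (1 + ϖ ^ j) - 1) = exp (-((2 * j : ℕ) : ℤ)) := by
    rw [valued_mul_self_sub_one_of_gt hgt, hϖj, ← WithZero.exp_add]
    congr 1; push_cast; ring
  have hlt : Valued.v w < Valued.v ((1 + ϖ ^ j) * (1 + ϖ ^ j) - 1) := by
    rw [hA]; exact hjw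
  rw [show (1 + ϖ ^ j) * (1 + ϖ ^ j) - (1 + w) = ((1 + ϖ ^ j) * (1 + ϖ ^ j) - 1) - w by ring,
    Valuation.map_sub_eq_of_lt_left _ hlt, hA]

end EvalOrder

end Literature.NumberTheory.LocalFields
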